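import Mathlib
import Summits.ValiantsHypothesis.ValiantsHypothesis.Theorems.FreeSubtorusOrbitDimensionBoundStubAbsorbingSacrificeFinalMatchingPrelim
import HarnessLib

/-!
# Route FreeSubtorus — crux `OrbitDimensionBound` (stmt-ValiantsHypothesis-16133), line `affine_multiple`,
# stub 2 `stub_absorbingSacrifice`, step (3): the FINAL MATCHING — re-matching at a mixed pin position

Sequel of `…FinalMatchingPrelim.lean` (same conventions: `a_k = Λ(·)(inl k)`, `b_l = Λ(·)(inr l)` in `ℚ^r`, support
set `S`, integer semi-invariance `hSI`).  Given a MAXIMUM independent matching `(ι, κ)` (size `s ≤ r`, `s + 4 ≤ n`)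
with no free support position and a support position `p₀` in a MIXED block, the trichotomy
`rematch_or_constant_coefficients` (`…StubAbsorbingSacrificeRematch.lean`) either re-matches the pair of `p₀` — after
which `p₀` is a diagonal pair or a free position of a new maximum independent matching, and `concl_of_free_or_diag`
finishes — or yields the RIGID configuration with constant `j₀`-coefficients, which is the pinned output:

* `concl_of_sacRow_freeCol` — `p₀ = (ι j₀, l₀)`, `l₀` unmatched: output clause `(ar ≡ α, ac ≡ α off l₀, ac l₀ = α + N)`;
* `concl_of_freeRow_sacCol` — `p₀ = (k₀, κ j₀)`, `k₀` unmatched (the lemma applied to `(−b, −a)`): output clause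
  `(ac ≡ α, ar ≡ α off k₀, ar k₀ + N = α)`.

Honest framing: helper plumbing for a registered stub of an OPEN crux on a conditional route; nothing here bears on
`VP ≠ VNP` (NOT proved).  No definitions, no named facts.
-/

-- the mandated summit-side namespace repeats a component by design (single-conjunct summit)
set_option linter.dupNamespace false

namespace Summit.ValiantsHypothesis.ValiantsHypothesis.Theorems.FreeSubtorusOrbitDimensionBound.AbsorbingSacrifice

open Finset Submodule
open Summit.ValiantsHypothesis.ValiantsHypothesis.Theorems.FreeSubtorusSubtorusCovering (indepMatching_span)

/-- **Pin in a matched row and a free column.**  Maximum independent matching `(ι, κ)`, no free support, support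
position `(ι j₀, l₀)` with `l₀` unmatched: either a re-matching of pair `j₀` makes it diagonal / free (then
`concl_of_free_or_diag`), or the rigid configuration gives the pinned output with constant `j₀`-coefficients.
[folklore] -/
theorem concl_of_sacRow_freeCol
    {n r s : ℕ} (Λ : Fin r → (Fin n ⊕ Fin n) → ℤ)
    (hrow : ∀ i, (∑ k, Λ i (Sum.inl k)) = 0) (S : Finset (Fin n × Fin n))
    (hSI : ∀ x y : Fin n → ℤ, (∀ i, (∑ k, x k * Λ i (Sum.inl k)) + (∑ l, y l * Λ i (Sum.inr l)) = 0) →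
      ∀ p₁ ∈ S, ∀ p₂ ∈ S, x p₁.1 + y p₁.2 = x p₂.1 + y p₂.2)
    (ι κ : Fin s ↪ Fin n) (hs : s ≤ r) (hn : s + 4 ≤ n)
    (hw : LinearIndependent ℚ (fun (t : Fin s) (i : Fin r) =>
      ((Λ i (Sum.inl (ι t)) : ℚ) - (Λ i (Sum.inr (κ t)) : ℚ))))
    (hmax : ∀ ι' κ' : Fin (s + 1) ↪ Fin n, ¬ LinearIndependent ℚ (fun (t : Fin (s + 1)) (i : Fin r) =>
      ((Λ i (Sum.inl (ι' t)) : ℚ) - (Λ i (Sum.inr (κ' t)) : ℚ))))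
    (hnofree : ∀ p ∈ S, p.1 ∈ Set.range ι ∨ p.2 ∈ Set.range κ)
    (j₀ : Fin s) (l₀ : Fin n) (hl₀ : l₀ ∉ Set.range κ) (hp₀ : (ι j₀, l₀) ∈ S) :
    ∃ (t : ℕ) (ι κ : Fin t ↪ Fin n) (N : ℕ) (ar ac : Fin n → Fin t → ℤ) (p₀ : Fin n × Fin n),
      t ≤ r + 1 ∧ 0 < N ∧
      (∀ k i, (N : ℤ) * Λ i (Sum.inl k) = ∑ j, ar k j * (Λ i (Sum.inl (ι j)) - Λ i (Sum.inr (κ j)))) ∧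
      (∀ l i, (N : ℤ) * Λ i (Sum.inr l) = ∑ j, ac l j * (Λ i (Sum.inl (ι j)) - Λ i (Sum.inr (κ j)))) ∧
      (∀ p ∈ S, p.1 ∈ Set.range ι ∨ p.2 ∈ Set.range κ) ∧ p₀ ∈ S ∧
      ((∃ j, p₀ = (ι j, κ j)) ∨
       (∃ (j₀ : Fin t) (l₀ : Fin n) (α : ℤ), p₀ = (ι j₀, l₀) ∧ l₀ ∉ Set.range κ ∧
          (∀ k, k ∉ Set.range ι → ar k j₀ = α) ∧ (∀ l, l ∉ Set.range κ → l ≠ l₀ → ac l j₀ = α) ∧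
          ac l₀ j₀ = α + N) ∨
       (∃ (k₀ : Fin n) (j₀ : Fin t) (α : ℤ), p₀ = (k₀, κ j₀) ∧ k₀ ∉ Set.range ι ∧
          (∀ l, l ∉ Set.range κ → ac l j₀ = α) ∧ (∀ k, k ∉ Set.range ι → k ≠ k₀ → ar k j₀ = α) ∧
          ar k₀ j₀ + N = α) ∨
       (∃ (j₀ j₁ : Fin t) (α₀ α₁ : ℤ), j₀ ≠ j₁ ∧ p₀ = (ι j₀, κ j₁) ∧
          (∀ k, k ∉ Set.range ι → ar k j₀ = α₀) ∧ (∀ l, l ∉ Set.range κ → ac l j₀ = α₀) ∧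
          (∀ k, k ∉ Set.range ι → ar k j₁ = α₁) ∧ (∀ l, l ∉ Set.range κ → ac l j₁ = α₁))) := by
  classical
  let a : Fin n → (Fin r → ℚ) := fun k i => (Λ i (Sum.inl k) : ℚ)
  let b : Fin n → (Fin r → ℚ) := fun l i => (Λ i (Sum.inr l) : ℚ)
  let D : Fin s → (Fin r → ℚ) := fun t => a (ι t) - b (κ t)
  have hw' : LinearIndependent ℚ D := hw
  have hmax' : ∀ ι' κ' : Fin (s + 1) ↪ Fin n, ¬ LinearIndependent ℚ (fun t => a (ι' t) - b (κ' t)) :=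
    fun ι' κ' h => hmax ι' κ' h
  have hspanQ : ∀ k l, a k - b l ∈ Submodule.span ℚ (Set.range D) :=
    indepMatching_span a b ι κ hw' hmax' (by omega)
  obtain ⟨N, ar, ac, hN, har, hac⟩ := intExpansions_of_span Λ hrow (by omega) ι κ (fun k l => hspanQ k l)
  -- rational form of the expansions
  have hcast : ∀ (c : Fin s → ℤ) (z : ℤ) (i : Fin r),
      (N : ℤ) * z = ∑ j, c j * (Λ i (Sum.inl (ι j)) - Λ i (Sum.inr (κ j))) →
      (N : ℚ) * (z : ℚ) = ∑ j, (c j : ℚ) * ((Λ i (Sum.inl (ι j)) : ℚ) - (Λ i (Sum.inr (κ j)) : ℚ)) := by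
    intro c z i h
    have h' : (((N : ℤ) * z : ℤ) : ℚ) = ((∑ j, c j * (Λ i (Sum.inl (ι j)) - Λ i (Sum.inr (κ j))) : ℤ) : ℚ) := by
      rw [h]
    push_cast at h'
    exact h'
  have harQ : ∀ k, (N : ℚ) • a k = ∑ j, (ar k j : ℚ) • D j := by
    intro k
    funext i
    simp only [a, b, D, Pi.smul_apply, Finset.sum_apply, Pi.sub_apply, smul_eq_mul]
    exact hcast (ar k) _ i (har k i)
  have hacQ : ∀ l, (N : ℚ) • b l = ∑ j, (ac l j : ℚ) • D j := by
    intro l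
    funext i
    simp only [a, b, D, Pi.smul_apply, Finset.sum_apply, Pi.sub_apply, smul_eq_mul]
    exact hcast (ac l) _ i (hac l i)
  -- enumerations of the free rows and the free columns by `Fin (n - s)`
  have hcR : Fintype.card {k : Fin n // k ∉ Set.range ι} = n - s := by
    rw [Fintype.card_subtype_compl, Fintype.card_fin, Set.card_range_of_injective ι.injective,
      Fintype.card_fin]
  have hcC : Fintype.card {l : Fin n // l ∉ Set.range κ} = n - s := by
    rw [Fintype.card_subtype_compl, Fintype.card_fin, Set.card_range_of_injective κ.injective,
      Fintype.card_fin]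
  let eR : Fin (n - s) ≃ {k : Fin n // k ∉ Set.range ι} := (Fintype.equivFinOfCardEq hcR).symm
  let eC : Fin (n - s) ≃ {l : Fin n // l ∉ Set.range κ} := (Fintype.equivFinOfCardEq hcC).symm
  let fr : Fin (n - s) → Fin n := fun i => (eR i).1
  let fc : Fin (n - s) → Fin n := fun i => (eC i).1
  have hfr : ∀ i, fr i ∉ Set.range ι := fun i => (eR i).2
  have hfc : ∀ i, fc i ∉ Set.range κ := fun i => (eC i).2
  have hfr_surj : ∀ k, k ∉ Set.range ι → ∃ i, fr i = k := fun k hk =>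
    ⟨eR.symm ⟨k, hk⟩, by simp [fr]⟩
  have hfc_surj : ∀ l, l ∉ Set.range κ → ∃ i, fc i = l := fun l hl =>
    ⟨eC.symm ⟨l, hl⟩, by simp [fc]⟩
  let i₀ : Fin (n - s) := eC.symm ⟨l₀, hl₀⟩
  have hi₀ : fc i₀ = l₀ := by simp [fc, i₀]
  have hfc_ne : ∀ l, l ≠ i₀ → fc l ≠ l₀ := by
    intro l hl h
    apply hl
    apply eC.injective
    apply Subtype.ext
    rw [show ((eC l : {l // l ∉ Set.range κ}) : Fin n) = fc l from rfl, h]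
    simp [i₀]
  rcases rematch_or_constant_coefficients D hw' (fun i => a (fr i)) (fun i => b (fc i)) (a (ι j₀)) (b (κ j₀))
      j₀ rfl N (fun i j => ar (fr i) j) (fun i j => ac (fc i) j) (fun i => harQ (fr i))
      (fun i => hacQ (fc i)) i₀ with h1 | ⟨k, l, hl, h2⟩ | ⟨k, h3⟩ | ⟨α, hα1, hα2, hα3⟩
  · -- (1) re-match pair `j₀` to `(ι j₀, l₀)`: the pin becomes a diagonal pair
    let κ₁ : Fin s ↪ Fin n := ⟨Function.update (⇑κ) j₀ l₀, update_injective_of_not_mem_range κ j₀ hl₀⟩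
    have hw₁ : LinearIndependent ℚ (fun (t : Fin s) (i : Fin r) =>
        ((Λ i (Sum.inl (ι t)) : ℚ) - (Λ i (Sum.inr (κ₁ t)) : ℚ))) := by
      have hfun : (fun (t : Fin s) (i : Fin r) => ((Λ i (Sum.inl (ι t)) : ℚ) - (Λ i (Sum.inr (κ₁ t)) : ℚ))) =
          Function.update D j₀ (a (ι j₀) - b (fc i₀)) := by
        funext t
        by_cases ht : t = j₀
        · subst ht
          rw [Function.update_self, hi₀]
          funext i
          simp [κ₁, a, b]
        · rw [Function.update_of_ne ht]
          funext i
          simp [κ₁, D, a, b, Function.update_of_ne ht]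
      rw [hfun]
      exact h1
    exact concl_of_free_or_diag Λ hrow S hSI ι κ₁ hs (by omega) hw₁ hmax (ι j₀, l₀) hp₀
      (Or.inr ⟨j₀, by simp [κ₁]⟩)
  · -- (2) re-match pair `j₀` to `(fr k, fc l)`, `fc l ≠ l₀`: the pin becomes free
    let ι₂ : Fin s ↪ Fin n :=
      ⟨Function.update (⇑ι) j₀ (fr k), update_injective_of_not_mem_range ι j₀ (hfr k)⟩
    let κ₂ : Fin s ↪ Fin n :=
      ⟨Function.update (⇑κ) j₀ (fc l), update_injective_of_not_mem_range κ j₀ (hfc l)⟩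
    have hw₂ : LinearIndependent ℚ (fun (t : Fin s) (i : Fin r) =>
        ((Λ i (Sum.inl (ι₂ t)) : ℚ) - (Λ i (Sum.inr (κ₂ t)) : ℚ))) := by
      have hfun : (fun (t : Fin s) (i : Fin r) => ((Λ i (Sum.inl (ι₂ t)) : ℚ) - (Λ i (Sum.inr (κ₂ t)) : ℚ))) =
          Function.update D j₀ (a (fr k) - b (fc l)) := by
        funext t
        by_cases ht : t = j₀
        · subst ht
          rw [Function.update_self]
          funext i
          simp [ι₂, κ₂, a, b]
        · rw [Function.update_of_ne ht]
          funext i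
          simp [ι₂, κ₂, D, a, b, Function.update_of_ne ht]
      rw [hfun]
      exact h2
    refine concl_of_free_or_diag Λ hrow S hSI ι₂ κ₂ hs (by omega) hw₂ hmax (ι j₀, l₀) hp₀ (Or.inl ⟨?_, ?_⟩)
    · exact self_not_mem_range_update ι j₀ (hfr k)
    · exact not_mem_range_update κ j₀ hl₀ (hfc_ne l hl).symm
  · -- (3) re-match pair `j₀` to `(fr k, κ j₀)`: the pin becomes free
    let ι₃ : Fin s ↪ Fin n :=
      ⟨Function.update (⇑ι) j₀ (fr k), update_injective_of_not_mem_range ι j₀ (hfr k)⟩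
    have hw₃ : LinearIndependent ℚ (fun (t : Fin s) (i : Fin r) =>
        ((Λ i (Sum.inl (ι₃ t)) : ℚ) - (Λ i (Sum.inr (κ t)) : ℚ))) := by
      have hfun : (fun (t : Fin s) (i : Fin r) => ((Λ i (Sum.inl (ι₃ t)) : ℚ) - (Λ i (Sum.inr (κ t)) : ℚ))) =
          Function.update D j₀ (a (fr k) - b (κ j₀)) := by
        funext t
        by_cases ht : t = j₀
        · subst ht
          rw [Function.update_self]
          funext i
          simp [ι₃, a, b]
        · rw [Function.update_of_ne ht]
          funext i
          simp [ι₃, D, a, b, Function.update_of_ne ht]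
      rw [hfun]
      exact h3
    refine concl_of_free_or_diag Λ hrow S hSI ι₃ κ hs (by omega) hw₃ hmax (ι j₀, l₀) hp₀ (Or.inl ⟨?_, hl₀⟩)
    exact self_not_mem_range_update ι j₀ (hfr k)
  · -- (4) rigid: pin at `(ι j₀, l₀)` with constant `j₀`-coefficients
    refine ⟨s, ι, κ, N, ar, ac, (ι j₀, l₀), by omega, hN, har, hac, hnofree, hp₀,
      Or.inr (Or.inl ⟨j₀, l₀, α, rfl, hl₀, fun k hk => ?_, fun l hl hne => ?_, ?_⟩)⟩
    · obtain ⟨i, rfl⟩ := hfr_surj k hk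
      exact hα1 i
    · obtain ⟨i, rfl⟩ := hfc_surj l hl
      exact hα2 i (fun h => hne (by rw [h, hi₀]))
    · rw [← hi₀]
      exact hα3

/-- **Pin in a free row and a matched column** (transpose twin, `rematch_or_constant_coefficients` applied to the
negated families `(−b, −a)`).  Maximum independent matching `(ι, κ)`, no free support, support position `(k₀, κ j₀)`
with `k₀` unmatched: re-match (then `concl_of_free_or_diag`) or the rigid pinned output `(ac ≡ α, ar ≡ α off k₀,
ar k₀ + N = α)`. [folklore] -/
theorem concl_of_freeRow_sacCol
    {n r s : ℕ} (Λ : Fin r → (Fin n ⊕ Fin n) → ℤ)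
    (hrow : ∀ i, (∑ k, Λ i (Sum.inl k)) = 0) (S : Finset (Fin n × Fin n))
    (hSI : ∀ x y : Fin n → ℤ, (∀ i, (∑ k, x k * Λ i (Sum.inl k)) + (∑ l, y l * Λ i (Sum.inr l)) = 0) →
      ∀ p₁ ∈ S, ∀ p₂ ∈ S, x p₁.1 + y p₁.2 = x p₂.1 + y p₂.2)
    (ι κ : Fin s ↪ Fin n) (hs : s ≤ r) (hn : s + 4 ≤ n)
    (hw : LinearIndependent ℚ (fun (t : Fin s) (i : Fin r) =>
      ((Λ i (Sum.inl (ι t)) : ℚ) - (Λ i (Sum.inr (κ t)) : ℚ))))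
    (hmax : ∀ ι' κ' : Fin (s + 1) ↪ Fin n, ¬ LinearIndependent ℚ (fun (t : Fin (s + 1)) (i : Fin r) =>
      ((Λ i (Sum.inl (ι' t)) : ℚ) - (Λ i (Sum.inr (κ' t)) : ℚ))))
    (hnofree : ∀ p ∈ S, p.1 ∈ Set.range ι ∨ p.2 ∈ Set.range κ)
    (k₀ : Fin n) (j₀ : Fin s) (hk₀ : k₀ ∉ Set.range ι) (hp₀ : (k₀, κ j₀) ∈ S) :
    ∃ (t : ℕ) (ι κ : Fin t ↪ Fin n) (N : ℕ) (ar ac : Fin n → Fin t → ℤ) (p₀ : Fin n × Fin n),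
      t ≤ r + 1 ∧ 0 < N ∧
      (∀ k i, (N : ℤ) * Λ i (Sum.inl k) = ∑ j, ar k j * (Λ i (Sum.inl (ι j)) - Λ i (Sum.inr (κ j)))) ∧
      (∀ l i, (N : ℤ) * Λ i (Sum.inr l) = ∑ j, ac l j * (Λ i (Sum.inl (ι j)) - Λ i (Sum.inr (κ j)))) ∧
      (∀ p ∈ S, p.1 ∈ Set.range ι ∨ p.2 ∈ Set.range κ) ∧ p₀ ∈ S ∧
      ((∃ j, p₀ = (ι j, κ j)) ∨
       (∃ (j₀ : Fin t) (l₀ : Fin n) (α : ℤ), p₀ = (ι j₀, l₀) ∧ l₀ ∉ Set.range κ ∧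
          (∀ k, k ∉ Set.range ι → ar k j₀ = α) ∧ (∀ l, l ∉ Set.range κ → l ≠ l₀ → ac l j₀ = α) ∧
          ac l₀ j₀ = α + N) ∨
       (∃ (k₀ : Fin n) (j₀ : Fin t) (α : ℤ), p₀ = (k₀, κ j₀) ∧ k₀ ∉ Set.range ι ∧
          (∀ l, l ∉ Set.range κ → ac l j₀ = α) ∧ (∀ k, k ∉ Set.range ι → k ≠ k₀ → ar k j₀ = α) ∧
          ar k₀ j₀ + N = α) ∨
       (∃ (j₀ j₁ : Fin t) (α₀ α₁ : ℤ), j₀ ≠ j₁ ∧ p₀ = (ι j₀, κ j₁) ∧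
          (∀ k, k ∉ Set.range ι → ar k j₀ = α₀) ∧ (∀ l, l ∉ Set.range κ → ac l j₀ = α₀) ∧
          (∀ k, k ∉ Set.range ι → ar k j₁ = α₁) ∧ (∀ l, l ∉ Set.range κ → ac l j₁ = α₁))) := by
  classical
  let a : Fin n → (Fin r → ℚ) := fun k i => (Λ i (Sum.inl k) : ℚ)
  let b : Fin n → (Fin r → ℚ) := fun l i => (Λ i (Sum.inr l) : ℚ)
  let D : Fin s → (Fin r → ℚ) := fun t => a (ι t) - b (κ t)
  have hw' : LinearIndependent ℚ D := hw
  have hmax' : ∀ ι' κ' : Fin (s + 1) ↪ Fin n, ¬ LinearIndependent ℚ (fun t => a (ι' t) - b (κ' t)) :=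
    fun ι' κ' h => hmax ι' κ' h
  have hspanQ : ∀ k l, a k - b l ∈ Submodule.span ℚ (Set.range D) :=
    indepMatching_span a b ι κ hw' hmax' (by omega)
  obtain ⟨N, ar, ac, hN, har, hac⟩ := intExpansions_of_span Λ hrow (by omega) ι κ (fun k l => hspanQ k l)
  -- rational form of the expansions
  have hcast : ∀ (c : Fin s → ℤ) (z : ℤ) (i : Fin r),
      (N : ℤ) * z = ∑ j, c j * (Λ i (Sum.inl (ι j)) - Λ i (Sum.inr (κ j))) →
      (N : ℚ) * (z : ℚ) = ∑ j, (c j : ℚ) * ((Λ i (Sum.inl (ι j)) : ℚ) - (Λ i (Sum.inr (κ j)) : ℚ)) := by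
    intro c z i h
    have h' : (((N : ℤ) * z : ℤ) : ℚ) = ((∑ j, c j * (Λ i (Sum.inl (ι j)) - Λ i (Sum.inr (κ j))) : ℤ) : ℚ) := by
      rw [h]
    push_cast at h'
    exact h'
  have harQ : ∀ k, (N : ℚ) • a k = ∑ j, (ar k j : ℚ) • D j := by
    intro k
    funext i
    simp only [a, b, D, Pi.smul_apply, Finset.sum_apply, Pi.sub_apply, smul_eq_mul]
    exact hcast (ar k) _ i (har k i)
  have hacQ : ∀ l, (N : ℚ) • b l = ∑ j, (ac l j : ℚ) • D j := by
    intro l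
    funext i
    simp only [a, b, D, Pi.smul_apply, Finset.sum_apply, Pi.sub_apply, smul_eq_mul]
    exact hcast (ac l) _ i (hac l i)
  -- enumerations of the free rows and the free columns by `Fin (n - s)`
  have hcR : Fintype.card {k : Fin n // k ∉ Set.range ι} = n - s := by
    rw [Fintype.card_subtype_compl, Fintype.card_fin, Set.card_range_of_injective ι.injective,
      Fintype.card_fin]
  have hcC : Fintype.card {l : Fin n // l ∉ Set.range κ} = n - s := by
    rw [Fintype.card_subtype_compl, Fintype.card_fin, Set.card_range_of_injective κ.injective,
      Fintype.card_fin]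
  let eR : Fin (n - s) ≃ {k : Fin n // k ∉ Set.range ι} := (Fintype.equivFinOfCardEq hcR).symm
  let eC : Fin (n - s) ≃ {l : Fin n // l ∉ Set.range κ} := (Fintype.equivFinOfCardEq hcC).symm
  let fr : Fin (n - s) → Fin n := fun i => (eR i).1
  let fc : Fin (n - s) → Fin n := fun i => (eC i).1
  have hfr : ∀ i, fr i ∉ Set.range ι := fun i => (eR i).2
  have hfc : ∀ i, fc i ∉ Set.range κ := fun i => (eC i).2
  have hfr_surj : ∀ k, k ∉ Set.range ι → ∃ i, fr i = k := fun k hk =>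
    ⟨eR.symm ⟨k, hk⟩, by simp [fr]⟩
  have hfc_surj : ∀ l, l ∉ Set.range κ → ∃ i, fc i = l := fun l hl =>
    ⟨eC.symm ⟨l, hl⟩, by simp [fc]⟩
  let i₀ : Fin (n - s) := eR.symm ⟨k₀, hk₀⟩
  have hi₀ : fr i₀ = k₀ := by simp [fr, i₀]
  have hfr_ne : ∀ k, k ≠ i₀ → fr k ≠ k₀ := by
    intro k hk h
    apply hk
    apply eR.injective
    apply Subtype.ext
    rw [show ((eR k : {k // k ∉ Set.range ι}) : Fin n) = fr k from rfl, h]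
    simp [i₀]
  have hD₀ : D j₀ = -(b (κ j₀)) - -(a (ι j₀)) := by
    simp only [D, sub_neg_eq_add]
    abel
  have harN : ∀ i, (N : ℚ) • (-(b (fc i))) = ∑ j, ((-ac (fc i) j : ℤ) : ℚ) • D j := by
    intro i
    rw [smul_neg, hacQ (fc i), ← Finset.sum_neg_distrib]
    refine Finset.sum_congr rfl fun j _ => ?_
    rw [Int.cast_neg, neg_smul]
  have hacN : ∀ i, (N : ℚ) • (-(a (fr i))) = ∑ j, ((-ar (fr i) j : ℤ) : ℚ) • D j := by
    intro i
    rw [smul_neg, harQ (fr i), ← Finset.sum_neg_distrib]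
    refine Finset.sum_congr rfl fun j _ => ?_
    rw [Int.cast_neg, neg_smul]
  rcases rematch_or_constant_coefficients D hw' (fun i => -(b (fc i))) (fun i => -(a (fr i))) (-(b (κ j₀)))
      (-(a (ι j₀))) j₀ hD₀ N (fun i j => -ac (fc i) j) (fun i j => -ar (fr i) j) harN hacN i₀
    with h1 | ⟨k, l, hl, h2⟩ | ⟨k, h3⟩ | ⟨α, hα1, hα2, hα3⟩
  · -- (1) re-match pair `j₀` to `(k₀, κ j₀)`: the pin becomes a diagonal pair
    let ι₁ : Fin s ↪ Fin n := ⟨Function.update (⇑ι) j₀ k₀, update_injective_of_not_mem_range ι j₀ hk₀⟩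
    have hw₁ : LinearIndependent ℚ (fun (t : Fin s) (i : Fin r) =>
        ((Λ i (Sum.inl (ι₁ t)) : ℚ) - (Λ i (Sum.inr (κ t)) : ℚ))) := by
      have hfun : (fun (t : Fin s) (i : Fin r) => ((Λ i (Sum.inl (ι₁ t)) : ℚ) - (Λ i (Sum.inr (κ t)) : ℚ))) =
          Function.update D j₀ (-(b (κ j₀)) - -(a (fr i₀))) := by
        funext t
        by_cases ht : t = j₀
        · subst ht
          rw [Function.update_self, hi₀]
          funext i
          simp [ι₁, a, b]
          ring
        · rw [Function.update_of_ne ht]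
          funext i
          simp [ι₁, D, a, b, Function.update_of_ne ht]
      rw [hfun]
      exact h1
    exact concl_of_free_or_diag Λ hrow S hSI ι₁ κ hs (by omega) hw₁ hmax (k₀, κ j₀) hp₀
      (Or.inr ⟨j₀, by simp [ι₁]⟩)
  · -- (2) re-match pair `j₀` to `(fr l, fc k)`, `fr l ≠ k₀`: the pin becomes free
    let ι₂ : Fin s ↪ Fin n :=
      ⟨Function.update (⇑ι) j₀ (fr l), update_injective_of_not_mem_range ι j₀ (hfr l)⟩
    let κ₂ : Fin s ↪ Fin n :=
      ⟨Function.update (⇑κ) j₀ (fc k), update_injective_of_not_mem_range κ j₀ (hfc k)⟩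
    have hw₂ : LinearIndependent ℚ (fun (t : Fin s) (i : Fin r) =>
        ((Λ i (Sum.inl (ι₂ t)) : ℚ) - (Λ i (Sum.inr (κ₂ t)) : ℚ))) := by
      have hfun : (fun (t : Fin s) (i : Fin r) => ((Λ i (Sum.inl (ι₂ t)) : ℚ) - (Λ i (Sum.inr (κ₂ t)) : ℚ))) =
          Function.update D j₀ (-(b (fc k)) - -(a (fr l))) := by
        funext t
        by_cases ht : t = j₀
        · subst ht
          rw [Function.update_self]
          funext i
          simp [ι₂, κ₂, a, b]
          ring
        · rw [Function.update_of_ne ht]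
          funext i
          simp [ι₂, κ₂, D, a, b, Function.update_of_ne ht]
      rw [hfun]
      exact h2
    refine concl_of_free_or_diag Λ hrow S hSI ι₂ κ₂ hs (by omega) hw₂ hmax (k₀, κ j₀) hp₀ (Or.inl ⟨?_, ?_⟩)
    · exact not_mem_range_update ι j₀ hk₀ (hfr_ne l hl).symm
    · exact self_not_mem_range_update κ j₀ (hfc k)
  · -- (3) re-match pair `j₀` to `(ι j₀, fc k)`: the pin becomes free
    let κ₃ : Fin s ↪ Fin n :=
      ⟨Function.update (⇑κ) j₀ (fc k), update_injective_of_not_mem_range κ j₀ (hfc k)⟩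
    have hw₃ : LinearIndependent ℚ (fun (t : Fin s) (i : Fin r) =>
        ((Λ i (Sum.inl (ι t)) : ℚ) - (Λ i (Sum.inr (κ₃ t)) : ℚ))) := by
      have hfun : (fun (t : Fin s) (i : Fin r) => ((Λ i (Sum.inl (ι t)) : ℚ) - (Λ i (Sum.inr (κ₃ t)) : ℚ))) =
          Function.update D j₀ (-(b (fc k)) - -(a (ι j₀))) := by
        funext t
        by_cases ht : t = j₀
        · subst ht
          rw [Function.update_self]
          funext i
          simp [κ₃, a, b]
          ring
        · rw [Function.update_of_ne ht]
          funext i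
          simp [κ₃, D, a, b, Function.update_of_ne ht]
      rw [hfun]
      exact h3
    refine concl_of_free_or_diag Λ hrow S hSI ι κ₃ hs (by omega) hw₃ hmax (k₀, κ j₀) hp₀ (Or.inl ⟨hk₀, ?_⟩)
    exact self_not_mem_range_update κ j₀ (hfc k)
  · -- (4) rigid: pin at `(k₀, κ j₀)` with constant `j₀`-coefficients (`α := -α̃`)
    refine ⟨s, ι, κ, N, ar, ac, (k₀, κ j₀), by omega, hN, har, hac, hnofree, hp₀,
      Or.inr (Or.inr (Or.inl ⟨k₀, j₀, -α, rfl, hk₀, fun l hl => ?_, fun k hk hne => ?_, ?_⟩))⟩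
    · obtain ⟨i, rfl⟩ := hfc_surj l hl
      have := hα1 i
      omega
    · obtain ⟨i, rfl⟩ := hfr_surj k hk
      have := hα2 i (fun h => hne (by rw [h, hi₀]))
      omega
    · have := hα3
      rw [hi₀] at this
      omega

end Summit.ValiantsHypothesis.ValiantsHypothesis.Theorems.FreeSubtorusOrbitDimensionBound.AbsorbingSacrifice
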